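import Summits.HodgeConjecture.CorCM.IrreducibleOddWeightsCommutantDensity
import HarnessLib

/-!
# Density over the commutant, VII: D-BASES and THE WEDDERBURN COUNT — `A` has a D-free D-spanning tuple of length
# `n = dim A / δ`; the restricted operator algebra `span(T)|_A` has `dim span(T)|_A · δ = (dim A)²`, the restricted
# commutant has `dim 𝒟|_A = δ`, and `dim 𝒟|_A · dim span(T)|_A = (dim A)²`

COR-CM (cell `pub-hodgecm2`, binder seat `b16` gen 73, count-neutral claim THE BICOMMUTANT AND HODGE DOMINATION,
file K1 — pure linear algebra; theorems only, no definition, no named fact, no `sorry`).  NEW as organised here, hence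
under `Summits/`.  HONEST FRAMING: the numerical half of the DOUBLE CENTRALIZER THEOREM for one simple module, in the
lane's unbundled shape (ONE ℚ-space `V`, a family of operators `T_i` closed under composition with identity, a stable
IRREDUCIBLE finite-dimensional `A ≤ V`, the commutant `𝒟` a PARAMETER with its characterising hypothesis, files
C1–C3): `A ≅ D^n`, `span(T)|_A ≅ M_n(D^{op})`, so `dim_ℚ span(T)|_A = n²δ`, `dim_ℚ D = δ`, `dim_ℚ A = nδ`.  Nothing
here names the division ring `D`, the integer `n` appears as the length of a D-basis, and `span(T)|_A` is the image
`(span T).map (LinearMap.domRestrict' A)` in `Hom_ℚ(A, V)`.  `HC_CM` is neither used nor asserted; nothing here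
mentions CM fields.

* §1 **D-BASES** (`exists_free_iSup_eq`): there are `n` and a D-FREE `b : Fin n → A` with `D⟨b⟩ = A` (file C2's
  exchange lemma on a ℚ-basis; D-freeness and D-spans transport along re-indexing); for any such `b`,
  **`n · δ = dim A`** (`card_mul_finrank_eq_of_free_of_iSup_eq`), and `𝔐(b) = A^n` by file C3's density
  `span_diag_orbit_eq_pi_of_free`.  A ℚ-spanning tuple of `A` D-spans `A` (`iSup_map_applyₗ_eq_of_le_span`).
* §2 **THE RESTRICTED OPERATOR ALGEBRA** `span(T)|_A = (span T).map (domRestrict' A) ≤ Hom_ℚ(A, V)`: evaluation on a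
  ℚ-spanning tuple `s` identifies it with the diagonal orbit module `𝔐(s)` (`finrank_map_domRestrict'_span_eq`), so
  file C3's dimension formula gives **THE WEDDERBURN COUNT `dim span(T)|_A · δ = (dim A)²`**
  (`finrank_map_domRestrict'_span_mul_eq`); hence `dim span(T)|_A ≤ (dim A)²` with EQUALITY IFF `δ = 1`
  (`finrank_map_domRestrict'_span_eq_sq_iff`: the dimension form of BURNSIDE's theorem — scalar commutant iff the
  operators restrict to ALL of `End_ℚ(A)`).
* §3 **THE RESTRICTED COMMUTANT** `𝒟|_A = 𝒟.map (domRestrict' A)`: evaluation at any `0 ≠ a₀ ∈ A` is injective on it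
  (Schur, file C1), onto the D-line `D·a₀`, so **`dim 𝒟|_A = δ`** (`finrank_map_domRestrict'_commutant_eq`), and
  **`dim 𝒟|_A · dim span(T)|_A = (dim A)²`** (`finrank_commutant_mul_finrank_span_restrict_eq`) — the double
  centralizer count.
File K2 (`…CommutantBicommutant`) proves the structural half: `span(T)|_A` IS the bicommutant restricted to `A`.

## References

* [Lang2002] S. Lang, *Algebra*, 3rd ed., XVII §1 Prop. 1.1, XVII §3 Thm. 3.2 and Cor. 3.3–3.5 (density, Burnside,
  Wedderburn).
* [CurtisReiner1962] C. W. Curtis, I. Reiner, *Representation Theory of Finite Groups and Associative Algebras*,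
  §27 ((27.3), (27.4) Burnside, (27.8)), §26 (Wedderburn).
* [Serre1977] J.-P. Serre, *Linear Representations of Finite Groups*, GTM 42, §2.2, §6.
-/

set_option autoImplicit false

noncomputable section

open scoped BigOperators Classical

universe u u' v w

namespace Summit.HodgeConjecture.CorCM.IrrOdd

variable {V : Type v} [AddCommGroup V] [Module ℚ V] {ι : Type w} (T : ι → V →ₗ[ℚ] V)

/-! ### §1 D-bases -/

omit [AddCommGroup V] [Module ℚ V] in
/-- D-freeness transports along a re-indexing of the tuple. [cite: Lang2002, XVII §1] -/
theorem free_comp_equiv [AddCommGroup V] [Module ℚ V] {𝒟 : Submodule ℚ (V →ₗ[ℚ] V)} {A : Submodule ℚ V}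
    {J : Type u} {J' : Type u'} [Fintype J] [Fintype J'] (e : J' ≃ J) {b : J → V}
    (hfree : ∀ L : J → (V →ₗ[ℚ] V), (∀ j, L j ∈ 𝒟) → ∑ j, L j (b j) = 0 → ∀ (j : J) (a : V), a ∈ A → L j a = 0) :
    ∀ L : J' → (V →ₗ[ℚ] V), (∀ j, L j ∈ 𝒟) → ∑ j, L j (b (e j)) = 0 →
      ∀ (j : J') (a : V), a ∈ A → L j a = 0 := by
  intro L hL hsum j a ha
  have hsum' : ∑ j, (fun j => L (e.symm j)) j (b j) = 0 := by
    rw [← hsum, ← e.sum_comp]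
    simp only [Equiv.symm_apply_apply]
  have h := hfree (fun j => L (e.symm j)) (fun j => hL _) hsum' (e j) a ha
  simpa only [Equiv.symm_apply_apply] using h

omit [AddCommGroup V] [Module ℚ V] in
/-- D-spans transport along a re-indexing of the tuple. [folklore] -/
theorem iSup_map_applyₗ_comp_equiv [AddCommGroup V] [Module ℚ V] (𝒟 : Submodule ℚ (V →ₗ[ℚ] V))
    {J : Type u} {J' : Type u'} (e : J' ≃ J) (b : J → V) :
    (⨆ j, 𝒟.map (LinearMap.applyₗ (b (e j)))) = ⨆ j, 𝒟.map (LinearMap.applyₗ (b j)) :=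
  Equiv.iSup_comp (g := fun j => 𝒟.map (LinearMap.applyₗ (b j))) e

/-- **A ℚ-SPANNING TUPLE OF `A` D-SPANS `A`**: `s_j ∈ A`, `A ≤ span_ℚ{s_j}` ⟹ `D⟨s⟩ = A`. [cite: Lang2002, XVII §1] -/
theorem iSup_map_applyₗ_eq_of_le_span {𝒟 : Submodule ℚ (V →ₗ[ℚ] V)} {A : Submodule ℚ V}
    (h𝒟 : ∀ L : V →ₗ[ℚ] V, L ∈ 𝒟 ↔ (∀ a ∈ A, L a ∈ A) ∧ ∀ (i : ι) (a : V), a ∈ A → L (T i a) = T i (L a))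
    {J : Type u} {s : J → V} (hs : ∀ j, s j ∈ A) (hle : A ≤ Submodule.span ℚ (Set.range s)) :
    (⨆ j, 𝒟.map (LinearMap.applyₗ (s j))) = A :=
  le_antisymm (iSup_map_applyₗ_le T h𝒟 hs) (hle.trans (span_range_le_iSup_map_applyₗ T h𝒟 s))

/-- The coerced ℚ-basis `Module.finBasis` of `A` spans `A` inside `V`. [folklore] -/
theorem le_span_range_finBasis (A : Submodule ℚ V) [FiniteDimensional ℚ A] :
    A ≤ Submodule.span ℚ (Set.range fun k => (Module.finBasis ℚ A k : V)) := by
  intro a ha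
  have h : (Submodule.span ℚ (Set.range (Module.finBasis ℚ A))).map A.subtype =
      Submodule.span ℚ (Set.range fun k => (Module.finBasis ℚ A k : V)) := by
    rw [Submodule.map_span, ← Set.range_comp]
    rfl
  rw [← h, (Module.finBasis ℚ A).span_eq, Submodule.map_subtype_top]
  exact ha

/-- **D-BASES EXIST**: `A` finite-dimensional stable irreducible, `T` closed under composition with identity ⟹ there
are `n` and a D-FREE tuple `b : Fin n → A` with **`D⟨b⟩ = A`** (a maximal D-free sub-tuple of a ℚ-basis, file C2).
[cite: Lang2002, XVII §1] [cite: CurtisReiner1962, §27 (27.3)] -/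
theorem exists_free_iSup_eq {𝒟 : Submodule ℚ (V →ₗ[ℚ] V)} {A : Submodule ℚ V} [FiniteDimensional ℚ A]
    (h𝒟 : ∀ L : V →ₗ[ℚ] V, L ∈ 𝒟 ↔ (∀ a ∈ A, L a ∈ A) ∧ ∀ (i : ι) (a : V), a ∈ A → L (T i a) = T i (L a))
    (hAst : ∀ (i : ι) (v : V), v ∈ A → T i v ∈ A)
    (hAirr : ∀ W : Submodule ℚ V, W ≤ A → W ≠ ⊥ → (∀ (i : ι) (v : V), v ∈ W → T i v ∈ W) → W = A) :
    ∃ (n : ℕ) (b : Fin n → V), (∀ k, b k ∈ A) ∧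
      (∀ L : Fin n → (V →ₗ[ℚ] V), (∀ k, L k ∈ 𝒟) → ∑ k, L k (b k) = 0 →
        ∀ (k : Fin n) (a : V), a ∈ A → L k a = 0) ∧
      (⨆ k, 𝒟.map (LinearMap.applyₗ (b k))) = A := by
  let s : Fin (Module.finrank ℚ A) → V := fun k => (Module.finBasis ℚ A k : V)
  have hs : ∀ k, s k ∈ A := fun k => (Module.finBasis ℚ A k).2
  obtain ⟨S, hSfree, hS⟩ := exists_free_subfamily T h𝒟 hAst hAirr hs
  have hDS : (⨆ k : ↥S, 𝒟.map (LinearMap.applyₗ (s k))) = A := by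
    rw [← iSup_map_applyₗ_eq_of_forall_mem T h𝒟 s S hS]
    exact iSup_map_applyₗ_eq_of_le_span T h𝒟 hs (le_span_range_finBasis A)
  let e : Fin S.card ≃ ↥S := (S.equivFin).symm
  refine ⟨S.card, fun k => s (e k), fun k => hs _, ?_, ?_⟩
  · exact free_comp_equiv (A := A) e (b := fun k : ↥S => s k) hSfree
  · rw [iSup_map_applyₗ_comp_equiv 𝒟 e (fun k : ↥S => s k)]
    exact hDS

/-- **THE LENGTH OF A D-BASIS: `n · δ = dim A`** for a D-free `b : J → A` with `D⟨b⟩ = A` (`0 ≠ a₀ ∈ A` names `δ`;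
file C2's count `dim D⟨b⟩ = |J|·δ`).  (`A ≅ D^n`.) [cite: Lang2002, XVII §1] [cite: CurtisReiner1962, §27 (27.3)] -/
theorem card_mul_finrank_eq_of_free_of_iSup_eq {𝒟 : Submodule ℚ (V →ₗ[ℚ] V)} {A : Submodule ℚ V}
    [FiniteDimensional ℚ A]
    (h𝒟 : ∀ L : V →ₗ[ℚ] V, L ∈ 𝒟 ↔ (∀ a ∈ A, L a ∈ A) ∧ ∀ (i : ι) (a : V), a ∈ A → L (T i a) = T i (L a))
    (h1 : ∃ i₀ : ι, T i₀ = LinearMap.id) (hmul : ∀ i i' : ι, ∃ i'' : ι, T i'' = T i ∘ₗ T i')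
    (hAst : ∀ (i : ι) (v : V), v ∈ A → T i v ∈ A)
    (hAirr : ∀ W : Submodule ℚ V, W ≤ A → W ≠ ⊥ → (∀ (i : ι) (v : V), v ∈ W → T i v ∈ W) → W = A)
    {J : Type u} [Fintype J] {b : J → V} (hb : ∀ j, b j ∈ A)
    (hfree : ∀ L : J → (V →ₗ[ℚ] V), (∀ j, L j ∈ 𝒟) → ∑ j, L j (b j) = 0 → ∀ (j : J) (a : V), a ∈ A → L j a = 0)
    (hspan : (⨆ j, 𝒟.map (LinearMap.applyₗ (b j))) = A) {a₀ : V} (ha₀ : a₀ ∈ A) (h0 : a₀ ≠ 0) :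
    Fintype.card J * Module.finrank ℚ ↥(𝒟.map (LinearMap.applyₗ a₀)) = Module.finrank ℚ A := by
  rw [← finrank_iSup_map_applyₗ_eq_card_mul_of_free T h𝒟 h1 hmul hAst hAirr hb hfree ha₀ h0, hspan]

/-! ### §2 The restricted operator algebra `span(T)|_A` and the Wedderburn count -/

/-- **EVALUATION ON A ℚ-SPANNING TUPLE IDENTIFIES `span(T)|_A` WITH `𝔐(s)`**: for `s_j ∈ A` with `A ≤ span_ℚ{s_j}`,
`dim (span T).map (domRestrict' A) = dim span{(T_i s_j)_j : i}` — a linear map on `A` is determined by its values on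
`s`. [cite: Lang2002, XVII §3] -/
theorem finrank_map_domRestrict'_span_eq {A : Submodule ℚ V} {J : Type u} {s : J → V} (hs : ∀ j, s j ∈ A)
    (hle : A ≤ Submodule.span ℚ (Set.range s)) :
    Module.finrank ℚ ↥((Submodule.span ℚ (Set.range T)).map (LinearMap.domRestrict' A)) =
      Module.finrank ℚ ↥(Submodule.span ℚ (Set.range fun i : ι => fun j : J => T i (s j))) := by
  -- evaluation on the tuple `s`, as a linear map `Hom(A, V) → V^J`
  let ev : (A →ₗ[ℚ] V) →ₗ[ℚ] (J → V) :=
    { toFun := fun f j => f ⟨s j, hs j⟩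
      map_add' := fun f f' => funext fun j => by simp
      map_smul' := fun t f => funext fun j => by simp }
  have hev : ∀ (f : A →ₗ[ℚ] V) (j : J), ev f j = f ⟨s j, hs j⟩ := fun f j => rfl
  -- the tuple `s`, seen in `A`, spans `A`
  have htop : Submodule.span ℚ (Set.range fun j => (⟨s j, hs j⟩ : A)) = ⊤ := by
    apply Submodule.map_injective_of_injective A.injective_subtype
    rw [Submodule.map_subtype_top, Submodule.map_span, ← Set.range_comp]
    exact le_antisymm (Submodule.span_le.2 (by rintro _ ⟨j, rfl⟩; exact hs j)) hle
  -- `ev` is injective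
  have hinj : Function.Injective ev := by
    intro f f' hff'
    refine LinearMap.ext_on_range htop fun j => ?_
    rw [← hev, ← hev, hff']
  -- `ev ∘ domRestrict' A` is `φ ↦ (φ s_j)_j`, which maps `span(T)` onto `𝔐(s)`
  have hcomp : ((Submodule.span ℚ (Set.range T)).map (LinearMap.domRestrict' A)).map ev =
      Submodule.span ℚ (Set.range fun i : ι => fun j : J => T i (s j)) := by
    rw [← Submodule.map_comp, Submodule.map_span, ← Set.range_comp]
    rfl
  rw [← hcomp]
  exact (Submodule.equivMapOfInjective ev hinj _).finrank_eq

/-- **THE WEDDERBURN COUNT: `dim span(T)|_A · δ = (dim A)²`** for `A` finite-dimensional stable irreducible, `T`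
closed under composition with identity, `δ = dim D·a₀` (`0 ≠ a₀ ∈ A`): `span(T)|_A ≅ 𝔐(s)` for a ℚ-basis `s`, whose
D-span is `A`, and file C3's `dim 𝔐(s)·δ = dim D⟨s⟩·dim A`.  (`span(T)|_A ≅ M_n(D^{op})`, `n²δ·δ = (nδ)²`.)
[cite: Lang2002, XVII §3 Cor. 3.5] [cite: CurtisReiner1962, §26 and §27 (27.8)] -/
theorem finrank_map_domRestrict'_span_mul_eq {𝒟 : Submodule ℚ (V →ₗ[ℚ] V)} {A : Submodule ℚ V}
    [FiniteDimensional ℚ A]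
    (h𝒟 : ∀ L : V →ₗ[ℚ] V, L ∈ 𝒟 ↔ (∀ a ∈ A, L a ∈ A) ∧ ∀ (i : ι) (a : V), a ∈ A → L (T i a) = T i (L a))
    (h1 : ∃ i₀ : ι, T i₀ = LinearMap.id) (hmul : ∀ i i' : ι, ∃ i'' : ι, T i'' = T i ∘ₗ T i')
    (hAst : ∀ (i : ι) (v : V), v ∈ A → T i v ∈ A)
    (hAirr : ∀ W : Submodule ℚ V, W ≤ A → W ≠ ⊥ → (∀ (i : ι) (v : V), v ∈ W → T i v ∈ W) → W = A)
    {a₀ : V} (ha₀ : a₀ ∈ A) (h0 : a₀ ≠ 0) :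
    Module.finrank ℚ ↥((Submodule.span ℚ (Set.range T)).map (LinearMap.domRestrict' A)) *
        Module.finrank ℚ ↥(𝒟.map (LinearMap.applyₗ a₀)) =
      Module.finrank ℚ A * Module.finrank ℚ A := by
  let s : Fin (Module.finrank ℚ A) → V := fun k => (Module.finBasis ℚ A k : V)
  have hs : ∀ k, s k ∈ A := fun k => (Module.finBasis ℚ A k).2
  have hle : A ≤ Submodule.span ℚ (Set.range s) := le_span_range_finBasis A
  rw [finrank_map_domRestrict'_span_eq T hs hle, finrank_span_diag_orbit_mul_eq T h𝒟 h1 hmul hAst hAirr hs ha₀ h0,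
    iSup_map_applyₗ_eq_of_le_span T h𝒟 hs hle]

/-- **`dim span(T)|_A ≤ (dim A)²`** (`δ ≥ 1`). [cite: Lang2002, XVII §3] -/
theorem finrank_map_domRestrict'_span_le_sq {𝒟 : Submodule ℚ (V →ₗ[ℚ] V)} {A : Submodule ℚ V}
    [FiniteDimensional ℚ A]
    (h𝒟 : ∀ L : V →ₗ[ℚ] V, L ∈ 𝒟 ↔ (∀ a ∈ A, L a ∈ A) ∧ ∀ (i : ι) (a : V), a ∈ A → L (T i a) = T i (L a))
    (h1 : ∃ i₀ : ι, T i₀ = LinearMap.id) (hmul : ∀ i i' : ι, ∃ i'' : ι, T i'' = T i ∘ₗ T i')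
    (hAst : ∀ (i : ι) (v : V), v ∈ A → T i v ∈ A)
    (hAirr : ∀ W : Submodule ℚ V, W ≤ A → W ≠ ⊥ → (∀ (i : ι) (v : V), v ∈ W → T i v ∈ W) → W = A) :
    Module.finrank ℚ ↥((Submodule.span ℚ (Set.range T)).map (LinearMap.domRestrict' A)) ≤
      Module.finrank ℚ A * Module.finrank ℚ A := by
  by_cases hA : A = ⊥
  · -- `A = 0`: every restriction vanishes
    have h : (Submodule.span ℚ (Set.range T)).map (LinearMap.domRestrict' A) = ⊥ := by
      rw [eq_bot_iff]
      rintro _ ⟨φ, -, rfl⟩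
      rw [Submodule.mem_bot]
      refine LinearMap.ext fun a => ?_
      have ha : (a : V) = 0 := (Submodule.mem_bot ℚ).1 (hA ▸ a.2)
      rw [LinearMap.domRestrict'_apply, ha, map_zero, LinearMap.zero_apply]
    rw [h, finrank_bot]
    exact Nat.zero_le _
  obtain ⟨a₀, ha₀, h0⟩ := Submodule.exists_mem_ne_zero_of_ne_bot hA
  have h := finrank_map_domRestrict'_span_mul_eq T h𝒟 h1 hmul hAst hAirr ha₀ h0
  haveI : FiniteDimensional ℚ ↥(𝒟.map (LinearMap.applyₗ a₀)) :=
    Submodule.finiteDimensional_of_le (map_applyₗ_le T h𝒟 ha₀)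
  have hδ : 0 < Module.finrank ℚ ↥(𝒟.map (LinearMap.applyₗ a₀)) :=
    Nat.pos_of_ne_zero fun h' => map_applyₗ_ne_bot T h𝒟 h0 (Submodule.finrank_eq_zero.1 h')
  nlinarith

/-- **BURNSIDE, DIMENSION FORM: `dim span(T)|_A = (dim A)² ⟺ δ = 1`** (`A ≠ 0` finite-dimensional stable
irreducible): the operators restrict to a subspace of `End_ℚ(A)` of full dimension `(dim A)²` exactly when the
commutant is SCALAR. [cite: Lang2002, XVII §3 Cor. 3.3–3.4] [cite: CurtisReiner1962, §27 (27.4)] -/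
theorem finrank_map_domRestrict'_span_eq_sq_iff {𝒟 : Submodule ℚ (V →ₗ[ℚ] V)} {A : Submodule ℚ V}
    [FiniteDimensional ℚ A]
    (h𝒟 : ∀ L : V →ₗ[ℚ] V, L ∈ 𝒟 ↔ (∀ a ∈ A, L a ∈ A) ∧ ∀ (i : ι) (a : V), a ∈ A → L (T i a) = T i (L a))
    (h1 : ∃ i₀ : ι, T i₀ = LinearMap.id) (hmul : ∀ i i' : ι, ∃ i'' : ι, T i'' = T i ∘ₗ T i')
    (hAst : ∀ (i : ι) (v : V), v ∈ A → T i v ∈ A)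
    (hAirr : ∀ W : Submodule ℚ V, W ≤ A → W ≠ ⊥ → (∀ (i : ι) (v : V), v ∈ W → T i v ∈ W) → W = A)
    {a₀ : V} (ha₀ : a₀ ∈ A) (h0 : a₀ ≠ 0) :
    Module.finrank ℚ ↥((Submodule.span ℚ (Set.range T)).map (LinearMap.domRestrict' A)) =
        Module.finrank ℚ A * Module.finrank ℚ A ↔
      Module.finrank ℚ ↥(𝒟.map (LinearMap.applyₗ a₀)) = 1 := by
  have h := finrank_map_domRestrict'_span_mul_eq T h𝒟 h1 hmul hAst hAirr ha₀ h0
  have hA : 0 < Module.finrank ℚ A := by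
    refine Nat.pos_of_ne_zero fun h' => h0 ?_
    have hbot : A = ⊥ := Submodule.finrank_eq_zero.1 h'
    exact (Submodule.mem_bot ℚ).1 (hbot ▸ ha₀)
  have hAA : 0 < Module.finrank ℚ A * Module.finrank ℚ A := Nat.mul_pos hA hA
  constructor
  · intro heq
    rw [heq] at h
    exact Nat.eq_of_mul_eq_mul_left hAA (h.trans (mul_one _).symm)
  · intro hδ
    rw [hδ, mul_one] at h
    exact h

/-! ### §3 The restricted commutant `𝒟|_A` and the double centralizer count -/

/-- **EVALUATION AT `a₀` MAPS `𝒟|_A` ONTO THE D-LINE `D·a₀`**: `(𝒟.map (domRestrict' A)).map (ev_{a₀}) = D·a₀`.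
[cite: CurtisReiner1962, §27 (27.3)] -/
theorem map_applyₗ_map_domRestrict'_commutant_eq (𝒟 : Submodule ℚ (V →ₗ[ℚ] V)) {A : Submodule ℚ V}
    {a₀ : V} (ha₀ : a₀ ∈ A) :
    (𝒟.map (LinearMap.domRestrict' A)).map (LinearMap.applyₗ (⟨a₀, ha₀⟩ : A)) =
      𝒟.map (LinearMap.applyₗ a₀) := by
  rw [← Submodule.map_comp]
  rfl

/-- **`dim 𝒟|_A = δ`**: for `A` stable irreducible and `0 ≠ a₀ ∈ A`, evaluation at `a₀` is INJECTIVE on the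
restricted commutant (an `L ∈ 𝒟` killing `a₀` is `0` on `A`, Schur) and onto `D·a₀`.  (`𝒟|_A ≅ D`.)
[cite: CurtisReiner1962, §27 (27.3)] [cite: Lang2002, XVII §1 Prop. 1.1] -/
theorem finrank_map_domRestrict'_commutant_eq {𝒟 : Submodule ℚ (V →ₗ[ℚ] V)} {A : Submodule ℚ V}
    (h𝒟 : ∀ L : V →ₗ[ℚ] V, L ∈ 𝒟 ↔ (∀ a ∈ A, L a ∈ A) ∧ ∀ (i : ι) (a : V), a ∈ A → L (T i a) = T i (L a))
    (hAst : ∀ (i : ι) (v : V), v ∈ A → T i v ∈ A)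
    (hAirr : ∀ W : Submodule ℚ V, W ≤ A → W ≠ ⊥ → (∀ (i : ι) (v : V), v ∈ W → T i v ∈ W) → W = A)
    {a₀ : V} (ha₀ : a₀ ∈ A) (h0 : a₀ ≠ 0) :
    Module.finrank ℚ ↥(𝒟.map (LinearMap.domRestrict' A)) = Module.finrank ℚ ↥(𝒟.map (LinearMap.applyₗ a₀)) := by
  let ev : (A →ₗ[ℚ] V) →ₗ[ℚ] V := LinearMap.applyₗ (⟨a₀, ha₀⟩ : A)
  -- injectivity on `𝒟|_A`
  have hk : LinearMap.ker (ev.domRestrict (𝒟.map (LinearMap.domRestrict' A))) = ⊥ := by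
    rw [eq_bot_iff]
    rintro ⟨_, ⟨L, hL, rfl⟩⟩ hf
    rw [LinearMap.mem_ker, LinearMap.domRestrict_apply] at hf
    change L a₀ = 0 at hf
    rw [Submodule.mem_bot]
    apply Subtype.ext
    change LinearMap.domRestrict' A L = 0
    rcases commutant_zero_or_injOn T h𝒟 hAst hAirr hL with hzero | hinj
    · exact LinearMap.ext fun a => by rw [LinearMap.domRestrict'_apply, hzero a a.2, LinearMap.zero_apply]
    · exact absurd (hinj a₀ ha₀ hf) h0
  have h := LinearMap.finrank_range_of_inj (LinearMap.ker_eq_bot.1 hk)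
  rw [LinearMap.range_domRestrict, map_applyₗ_map_domRestrict'_commutant_eq 𝒟 ha₀] at h
  exact h.symm

/-- **THE DOUBLE CENTRALIZER COUNT: `dim 𝒟|_A · dim span(T)|_A = (dim A)²`** for `A ≠ 0` finite-dimensional stable
irreducible, `T` closed under composition with identity (`𝒟|_A = 𝒟.map (domRestrict' A)`,
`span(T)|_A = (span T).map (domRestrict' A)`): `δ · n²δ = (nδ)²`. [cite: Lang2002, XVII §3 Cor. 3.5]
[cite: CurtisReiner1962, §26] -/
theorem finrank_commutant_mul_finrank_span_restrict_eq {𝒟 : Submodule ℚ (V →ₗ[ℚ] V)} {A : Submodule ℚ V}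
    [FiniteDimensional ℚ A]
    (h𝒟 : ∀ L : V →ₗ[ℚ] V, L ∈ 𝒟 ↔ (∀ a ∈ A, L a ∈ A) ∧ ∀ (i : ι) (a : V), a ∈ A → L (T i a) = T i (L a))
    (h1 : ∃ i₀ : ι, T i₀ = LinearMap.id) (hmul : ∀ i i' : ι, ∃ i'' : ι, T i'' = T i ∘ₗ T i')
    (hAst : ∀ (i : ι) (v : V), v ∈ A → T i v ∈ A)
    (hAirr : ∀ W : Submodule ℚ V, W ≤ A → W ≠ ⊥ → (∀ (i : ι) (v : V), v ∈ W → T i v ∈ W) → W = A)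
    (hA : A ≠ ⊥) :
    Module.finrank ℚ ↥(𝒟.map (LinearMap.domRestrict' A)) *
        Module.finrank ℚ ↥((Submodule.span ℚ (Set.range T)).map (LinearMap.domRestrict' A)) =
      Module.finrank ℚ A * Module.finrank ℚ A := by
  obtain ⟨a₀, ha₀, h0⟩ := Submodule.exists_mem_ne_zero_of_ne_bot hA
  rw [finrank_map_domRestrict'_commutant_eq T h𝒟 hAst hAirr ha₀ h0, mul_comm]
  exact finrank_map_domRestrict'_span_mul_eq T h𝒟 h1 hmul hAst hAirr ha₀ h0

/-- **`δ² ∣ (dim A)²`-companion: `dim 𝒟|_A ∣ dim A`** (`= δ ∣ dim A`, file C1, in the restricted-commutant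
currency). [cite: CurtisReiner1962, §27 (27.3)] -/
theorem finrank_map_domRestrict'_commutant_dvd_finrank {𝒟 : Submodule ℚ (V →ₗ[ℚ] V)} {A : Submodule ℚ V}
    [FiniteDimensional ℚ A]
    (h𝒟 : ∀ L : V →ₗ[ℚ] V, L ∈ 𝒟 ↔ (∀ a ∈ A, L a ∈ A) ∧ ∀ (i : ι) (a : V), a ∈ A → L (T i a) = T i (L a))
    (h1 : ∃ i₀ : ι, T i₀ = LinearMap.id) (hmul : ∀ i i' : ι, ∃ i'' : ι, T i'' = T i ∘ₗ T i')
    (hAst : ∀ (i : ι) (v : V), v ∈ A → T i v ∈ A)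
    (hAirr : ∀ W : Submodule ℚ V, W ≤ A → W ≠ ⊥ → (∀ (i : ι) (v : V), v ∈ W → T i v ∈ W) → W = A)
    (hA : A ≠ ⊥) :
    Module.finrank ℚ ↥(𝒟.map (LinearMap.domRestrict' A)) ∣ Module.finrank ℚ A := by
  obtain ⟨a₀, ha₀, h0⟩ := Submodule.exists_mem_ne_zero_of_ne_bot hA
  rw [finrank_map_domRestrict'_commutant_eq T h𝒟 hAst hAirr ha₀ h0]
  exact finrank_map_applyₗ_dvd_finrank T h𝒟 h1 hmul hAst hAirr ha₀ h0

/-- **`dim span(T)|_A = n² · δ`** for a D-basis of length `n` (`n·δ = dim A`). [cite: Lang2002, XVII §3 Cor. 3.5]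
[cite: CurtisReiner1962, §26] -/
theorem finrank_map_domRestrict'_span_eq_card_sq_mul {𝒟 : Submodule ℚ (V →ₗ[ℚ] V)} {A : Submodule ℚ V}
    [FiniteDimensional ℚ A]
    (h𝒟 : ∀ L : V →ₗ[ℚ] V, L ∈ 𝒟 ↔ (∀ a ∈ A, L a ∈ A) ∧ ∀ (i : ι) (a : V), a ∈ A → L (T i a) = T i (L a))
    (h1 : ∃ i₀ : ι, T i₀ = LinearMap.id) (hmul : ∀ i i' : ι, ∃ i'' : ι, T i'' = T i ∘ₗ T i')
    (hAst : ∀ (i : ι) (v : V), v ∈ A → T i v ∈ A)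
    (hAirr : ∀ W : Submodule ℚ V, W ≤ A → W ≠ ⊥ → (∀ (i : ι) (v : V), v ∈ W → T i v ∈ W) → W = A)
    {J : Type u} [Fintype J] {b : J → V} (hb : ∀ j, b j ∈ A)
    (hfree : ∀ L : J → (V →ₗ[ℚ] V), (∀ j, L j ∈ 𝒟) → ∑ j, L j (b j) = 0 → ∀ (j : J) (a : V), a ∈ A → L j a = 0)
    (hspan : (⨆ j, 𝒟.map (LinearMap.applyₗ (b j))) = A) {a₀ : V} (ha₀ : a₀ ∈ A) (h0 : a₀ ≠ 0) :
    Module.finrank ℚ ↥((Submodule.span ℚ (Set.range T)).map (LinearMap.domRestrict' A)) =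
      Fintype.card J * Fintype.card J * Module.finrank ℚ ↥(𝒟.map (LinearMap.applyₗ a₀)) := by
  have h := finrank_map_domRestrict'_span_mul_eq T h𝒟 h1 hmul hAst hAirr ha₀ h0
  rw [← card_mul_finrank_eq_of_free_of_iSup_eq T h𝒟 h1 hmul hAst hAirr hb hfree hspan ha₀ h0] at h
  haveI : FiniteDimensional ℚ ↥(𝒟.map (LinearMap.applyₗ a₀)) :=
    Submodule.finiteDimensional_of_le (map_applyₗ_le T h𝒟 ha₀)
  have hδ : 0 < Module.finrank ℚ ↥(𝒟.map (LinearMap.applyₗ a₀)) :=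
    Nat.pos_of_ne_zero fun h' => map_applyₗ_ne_bot T h𝒟 h0 (Submodule.finrank_eq_zero.1 h')
  apply Nat.eq_of_mul_eq_mul_right hδ
  rw [h]
  ring

end Summit.HodgeConjecture.CorCM.IrrOdd

end
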